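import Mathlib.Algebra.QuadraticAlgebra.Basic
import Literature.NumberTheory.EllipticCurves.TwoDescentLocalGeneral
import HarnessLib

/-!
# The odd place of a quadratic field at an inert prime, read off the norm

For the `2`-descents over `K = ℚ(√41)`, `ℚ(√73)`, `ℚ(√-1)` of the rank computation
`rk E(F₄) = 6` (`E = 480a1`; T. Dokchitser–V. Dokchitser, *A note on the Mordell–Weil rank
modulo n*, J. Number Theory 131 (2011), proof of Thm. 2) one needs the local conditions at the
INERT odd primes `3` (in `ℚ(√41)`, `ℚ(√-1)`) and `5` (in `ℚ(√73)`), whose completions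
`K_𝔭 = ℚ_p(√d)` are not available in Mathlib. The abstract form
`OddPlace.local_conditions_of_mult` (`TwoDescentLocalGeneral.lean`) only needs a valuation and a
residue bit with four axioms, and at an inert prime both can be read off the norm
`N(x + yω) = x² - a y²` (`ω² = a`) down in `ℚ`:

* `v_𝔭(z) = v_p(N z) / 2` — because the norm form is anisotropic modulo `p` (`a` a `p`-unit and a
  non-square mod `p`), `v_p(N z) = 2 · min(v_p(x), v_p(y))` (`padicValRat_norm_eq_two_mul`);
* `χ_𝔭(z) = χ_p(N z)`, the quadratic-residue bit of the `p`-unit part of the norm — the residue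
  field is `𝔽_{p²}` and `u ∈ 𝔽_{p²}ˣ` is a square iff `N(u) = u^{p+1}` is a square in `𝔽_pˣ`;
  for the descent only the four axioms matter, and they follow from the multiplicativity of the
  norm and the tree's rational lemmas (`qrBit_mul`, `res_add_of_lt`).

Main definitions and results (namespace `Literature.NumberTheory.EllipticCurves.TwoDescentLocal`),
for `K = QuadraticAlgebra ℚ a 0` a field and a prime `p` with `v_p(a) = 0`, `a mod p` a
non-square:

* `QuadInert.Dom p m z` (both coordinates are `0` or have `v_p ≥ m`), `QuadInert.cval`
  (the minimum of the valuations of the non-zero coordinates),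
  `QuadInert.padicValRat_norm_eq_two_mul : v_p(N z) = 2 · cval z` (`z ≠ 0`);
* `inertPlace : OddPlace (QuadraticAlgebra ℚ a 0)` with `v z = v_p(N z) / 2`,
  `χ z = qrBit p (N z)`, and the unfolding lemmas `inertPlace_v`, `inertPlace_χ`,
  `inertPlace_v_eq_cval`.

Everything is proved; no named facts.

## References

* J. H. Silverman, *The Arithmetic of Elliptic Curves*, 2nd ed., GTM 106 (2009), X.1
  (Prop. X.1.4, Example X.1.5). [SilvermanAEC2009]
* T. Dokchitser, V. Dokchitser, *A note on the Mordell–Weil rank modulo n*, J. Number Theory 131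
  (2011) 1833–1839, proof of Thm. 2. [DokchitserDokchitser2011RankModN]
-/

noncomputable section

open scoped Classical

open QuadraticAlgebra

namespace Literature.NumberTheory.EllipticCurves.TwoDescentLocal

open Literature.NumberTheory.EllipticCurves.KramerTwoDescent

namespace QuadInert

variable (p : ℕ) [hp : Fact p.Prime] {a : ℚ}

/-! ### Coordinates: the lattices `p^m (ℤ_(p) ⊕ ℤ_(p) ω)` -/

/-- `Dom p m z`: both coordinates of `z = x + yω` are `0` or have `v_p ≥ m`
(i.e. `z ∈ p^m (ℤ_(p) ⊕ ℤ_(p) ω)`). [folklore] -/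
def Dom (m : ℤ) (z : QuadraticAlgebra ℚ a 0) : Prop :=
  (z.re = 0 ∨ m ≤ padicValRat p z.re) ∧ (z.im = 0 ∨ m ≤ padicValRat p z.im)

/-- `Dom` is stable under addition (ultrametric inequality coordinatewise). [folklore] -/
theorem Dom.add {m : ℤ} {z w : QuadraticAlgebra ℚ a 0} (hz : Dom p m z) (hw : Dom p m w) :
    Dom p m (z + w) := by
  refine ⟨?_, ?_⟩
  · rw [re_add]; exact le_padicValRat_add_or hz.1 hw.1
  · rw [im_add]; exact le_padicValRat_add_or hz.2 hw.2

omit hp in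
/-- `Dom` is monotone in `m`. [folklore] -/
theorem Dom.mono {m m' : ℤ} (h : m' ≤ m) {z : QuadraticAlgebra ℚ a 0} (hz : Dom p m z) :
    Dom p m' z :=
  ⟨hz.1.imp_right fun h1 => h.trans h1, hz.2.imp_right fun h2 => h.trans h2⟩

/-- The coordinate valuation: the minimum of `v_p` over the non-zero coordinates (junk for
`z = 0`). [folklore] -/
def cval (z : QuadraticAlgebra ℚ a 0) : ℤ :=
  if z.im = 0 then padicValRat p z.re
  else if z.re = 0 then padicValRat p z.im else min (padicValRat p z.re) (padicValRat p z.im)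

omit hp in
/-- `z ∈ p^{cval z} (ℤ_(p) ⊕ ℤ_(p) ω)`. [folklore] -/
theorem dom_cval (z : QuadraticAlgebra ℚ a 0) : Dom p (cval p z) z := by
  unfold cval
  by_cases hi : z.im = 0
  · rw [if_pos hi]; exact ⟨Or.inr le_rfl, Or.inl hi⟩
  · rw [if_neg hi]
    by_cases hr : z.re = 0
    · rw [if_pos hr]; exact ⟨Or.inl hr, Or.inr le_rfl⟩
    · rw [if_neg hr]; exact ⟨Or.inr (min_le_left _ _), Or.inr (min_le_right _ _)⟩

omit hp in
/-- Conversely `Dom p m z` with `z ≠ 0` forces `m ≤ cval z`. [folklore] -/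
theorem le_cval_of_dom {m : ℤ} {z : QuadraticAlgebra ℚ a 0} (hz : z ≠ 0) (h : Dom p m z) :
    m ≤ cval p z := by
  unfold cval
  by_cases hi : z.im = 0
  · rw [if_pos hi]
    have hr : z.re ≠ 0 := fun hr => hz (QuadraticAlgebra.ext hr hi)
    exact h.1.resolve_left hr
  · rw [if_neg hi]
    by_cases hr : z.re = 0
    · rw [if_pos hr]; exact h.2.resolve_left hi
    · rw [if_neg hr]; exact le_min (h.1.resolve_left hr) (h.2.resolve_left hi)

omit hp in
/-- At valuation `cval z` one of the coordinates is exact: `z ≠ 0` has a coordinate `t ≠ 0` with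
`v_p(t) = cval z`. [folklore] -/
theorem exists_coord_eq_cval {z : QuadraticAlgebra ℚ a 0} (hz : z ≠ 0) :
    (z.re ≠ 0 ∧ padicValRat p z.re = cval p z) ∨ (z.im ≠ 0 ∧ padicValRat p z.im = cval p z) := by
  unfold cval
  by_cases hi : z.im = 0
  · rw [if_pos hi]
    exact Or.inl ⟨fun hr => hz (QuadraticAlgebra.ext hr hi), rfl⟩
  · rw [if_neg hi]
    by_cases hr : z.re = 0
    · rw [if_pos hr]; exact Or.inr ⟨hi, rfl⟩
    · rw [if_neg hr]
      rcases le_total (padicValRat p z.re) (padicValRat p z.im) with hle | hle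
      · exact Or.inl ⟨hr, (min_eq_left hle).symm⟩
      · exact Or.inr ⟨hi, (min_eq_right hle).symm⟩

/-- Scaling by `p^k` shifts `cval`. [folklore] -/
theorem cval_smul_zpow (k : ℤ) {z : QuadraticAlgebra ℚ a 0} (hz : z ≠ 0) :
    cval p (((p : ℚ) ^ k) • z) = k + cval p z := by
  have hp0 : (p : ℚ) ≠ 0 := Nat.cast_ne_zero.mpr hp.out.ne_zero
  have hpk : (p : ℚ) ^ k ≠ 0 := zpow_ne_zero _ hp0
  have hv : ∀ {t : ℚ}, t ≠ 0 → padicValRat p ((p : ℚ) ^ k * t) = k + padicValRat p t := by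
    intro t ht
    rw [padicValRat.mul hpk ht, padicValRat.zpow, padicValRat.self hp.out.one_lt, mul_one]
  unfold cval
  simp only [re_smul, im_smul, smul_eq_mul, mul_eq_zero, hpk, false_or]
  by_cases hi : z.im = 0
  · have hr : z.re ≠ 0 := fun hr => hz (QuadraticAlgebra.ext hr hi)
    rw [if_pos hi, if_pos hi, hv hr]
  · rw [if_neg hi, if_neg hi]
    by_cases hr : z.re = 0
    · rw [if_pos hr, if_pos hr, hv hi]
    · rw [if_neg hr, if_neg hr, hv hr, hv hi, min_add_add_left]

/-! ### The norm form is anisotropic mod `p` -/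

/-- The norm of `x + yω` (`ω² = a`) is `x² - a y²`. [folklore] -/
theorem norm_eq (z : QuadraticAlgebra ℚ a 0) : z.norm = z.re ^ 2 - a * z.im ^ 2 := by
  rw [norm_def]; ring

/-- `N(c • z) = c² N(z)`. [folklore] -/
theorem norm_smul (c : ℚ) (z : QuadraticAlgebra ℚ a 0) : (c • z).norm = c ^ 2 * z.norm := by
  rw [norm_eq, norm_eq, re_smul, im_smul, smul_eq_mul, smul_eq_mul]; ring

variable {p}

/-- **Anisotropy of the norm form mod `p`**: if `v_p(a) = 0`, `a` is a non-square mod `p`, and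
`x, y` are `p`-integral with one of them a `p`-unit, then `x² - a y²` (assumed `≠ 0`) is a
`p`-unit. [folklore] -/
theorem padicValRat_norm_form_eq_zero (ha : padicValRat p a = 0) (hns : ¬ IsSquare (res p a))
    {x y : ℚ} (hx : x = 0 ∨ 0 ≤ padicValRat p x) (hy : y = 0 ∨ 0 ≤ padicValRat p y)
    (hunit : (x ≠ 0 ∧ padicValRat p x = 0) ∨ (y ≠ 0 ∧ padicValRat p y = 0))
    (hN : x ^ 2 - a * y ^ 2 ≠ 0) : padicValRat p (x ^ 2 - a * y ^ 2) = 0 := by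
  have ha0 : a ≠ 0 := by
    rintro rfl
    exact hns ⟨0, by rw [res, unitPart, zero_div, Rat.cast_zero, mul_zero]⟩
  -- valuations of the pieces
  have vx2 : ∀ {t : ℚ}, t ≠ 0 → padicValRat p (t ^ 2) = 2 * padicValRat p t := fun ht => by
    rw [padicValRat.pow]; rfl
  have vay2 : ∀ {t : ℚ}, t ≠ 0 → padicValRat p (a * t ^ 2) = 2 * padicValRat p t := fun ht => by
    rw [padicValRat.mul ha0 (pow_ne_zero 2 ht), padicValRat.pow, ha]; ring
  -- Step 1: reduce to the case where `y` is a unit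
  have key : ∀ {x y : ℚ}, (x = 0 ∨ 0 ≤ padicValRat p x) → y ≠ 0 → padicValRat p y = 0 →
      x ^ 2 - a * y ^ 2 ≠ 0 → padicValRat p (x ^ 2 - a * y ^ 2) = 0 := by
    intro x y hx hy0 hvy hN
    have hay : a * y ^ 2 ≠ 0 := mul_ne_zero ha0 (pow_ne_zero 2 hy0)
    have hge : 0 ≤ padicValRat p (x ^ 2 - a * y ^ 2) := by
      have h1 : x ^ 2 = 0 ∨ 0 ≤ padicValRat p (x ^ 2) := by
        rcases hx with rfl | hx
        · exact Or.inl (by ring)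
        · by_cases hx0 : x = 0
          · exact Or.inl (by rw [hx0]; ring)
          · exact Or.inr (by rw [vx2 hx0]; omega)
      have h2 : -(a * y ^ 2) = 0 ∨ 0 ≤ padicValRat p (-(a * y ^ 2)) :=
        Or.inr (by rw [padicValRat.neg, vay2 hy0, hvy]; norm_num)
      rcases le_padicValRat_add_or (p := p) h1 h2 with h | h
      · exact absurd (by rw [sub_eq_add_neg]; exact h) hN
      · rwa [← sub_eq_add_neg] at h
    by_contra hne
    have hpos : 0 < padicValRat p (x ^ 2 - a * y ^ 2) := lt_of_le_of_ne hge (Ne.symm hne)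
    -- `a y² = x² - N`
    have e : a * y ^ 2 = x ^ 2 + -(x ^ 2 - a * y ^ 2) := by ring
    rcases hx with rfl | hx
    · -- `x = 0`: `a y² = -N` has positive valuation, absurd
      have : padicValRat p (a * y ^ 2) = padicValRat p (-(0 ^ 2 - a * y ^ 2)) :=
        congrArg _ (by ring)
      rw [vay2 hy0, hvy, padicValRat.neg] at this
      omega
    · by_cases hx0 : x = 0
      · subst hx0
        have : padicValRat p (a * y ^ 2) = padicValRat p (-(0 ^ 2 - a * y ^ 2)) :=
          congrArg _ (by ring)
        rw [vay2 hy0, hvy, padicValRat.neg] at this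
        omega
      rcases (show padicValRat p x = 0 ∨ 1 ≤ padicValRat p x by omega) with hvx | hvx
      · -- `x` a unit: residues give `res a · (res y)² = (res x)²`, so `res a` is a square
        have hres : res p (a * y ^ 2) = res p (x ^ 2) := by
          rw [e]
          exact res_add_of_lt p (pow_ne_zero 2 hx0)
            (Or.inr (by rw [padicValRat.neg, vx2 hx0, hvx]; simpa using hpos))
        rw [res_mul p ha0 (pow_ne_zero 2 hy0), sq, sq, res_mul p hy0 hy0, res_mul p hx0 hx0] at hres
        have hry : res p y ≠ 0 := res_ne_zero p hy0
        apply hns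
        refine ⟨res p x * (res p y)⁻¹, ?_⟩
        field_simp
        linear_combination hres
      · -- `v(x) ≥ 1`: then `a y² = x² - N` has positive valuation, absurd
        have h1 : x ^ 2 = 0 ∨ 1 ≤ padicValRat p (x ^ 2) := Or.inr (by rw [vx2 hx0]; omega)
        have h2 : -(x ^ 2 - a * y ^ 2) = 0 ∨ 1 ≤ padicValRat p (-(x ^ 2 - a * y ^ 2)) :=
          Or.inr (by rw [padicValRat.neg]; omega)
        rcases le_padicValRat_add_or (p := p) h1 h2 with h | h
        · exact hay (by rw [e]; exact h)
        · rw [← e, vay2 hy0, hvy] at h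
          omega
  -- Step 2: the case distinction on which coordinate is the unit
  rcases hunit with ⟨hx0, hvx⟩ | ⟨hy0, hvy⟩
  · rcases hy with rfl | hy
    · -- `y = 0`: `N = x²` is a unit
      rw [show x ^ 2 - a * (0 : ℚ) ^ 2 = x ^ 2 by ring, vx2 hx0, hvx]; rfl
    · by_cases hy0 : y = 0
      · subst hy0
        rw [show x ^ 2 - a * (0 : ℚ) ^ 2 = x ^ 2 by ring, vx2 hx0, hvx]; rfl
      rcases (show padicValRat p y = 0 ∨ 1 ≤ padicValRat p y by omega) with hvy | hvy
      · exact key hx hy0 hvy hN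
      · -- `v(y) ≥ 1`: `x² = N + a y²` with `v(x²) = 0`, so `v(N) = 0`
        by_contra hne
        have hge : 0 ≤ padicValRat p (x ^ 2 - a * y ^ 2) := by
          have h1 : x ^ 2 = 0 ∨ 0 ≤ padicValRat p (x ^ 2) := Or.inr (by rw [vx2 hx0, hvx]; rfl)
          have h2 : -(a * y ^ 2) = 0 ∨ 0 ≤ padicValRat p (-(a * y ^ 2)) :=
            Or.inr (by rw [padicValRat.neg, vay2 hy0]; omega)
          rcases le_padicValRat_add_or (p := p) h1 h2 with h | h
          · exact absurd (by rw [sub_eq_add_neg]; exact h) hN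
          · rwa [← sub_eq_add_neg] at h
        have hpos : 1 ≤ padicValRat p (x ^ 2 - a * y ^ 2) := by omega
        have e : x ^ 2 = (x ^ 2 - a * y ^ 2) + a * y ^ 2 := by ring
        have h1 : x ^ 2 - a * y ^ 2 = 0 ∨ 1 ≤ padicValRat p (x ^ 2 - a * y ^ 2) := Or.inr hpos
        have h2 : a * y ^ 2 = 0 ∨ 1 ≤ padicValRat p (a * y ^ 2) :=
          Or.inr (by rw [vay2 hy0]; omega)
        rcases le_padicValRat_add_or (p := p) h1 h2 with h | h
        · exact pow_ne_zero 2 hx0 (by rw [e]; exact h)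
        · rw [← e, vx2 hx0, hvx] at h
          omega
  · exact key hx hy0 hvy hN

variable (p)

/-- **`v_p(N z) = 2 cval z`** for `z ≠ 0` (`a` a `p`-unit non-square mod `p`): the norm form
is anisotropic modulo `p`. [folklore] -/
theorem padicValRat_norm_eq_two_mul [Fact (∀ r : ℚ, r ^ 2 ≠ a + 0 * r)]
    (ha : padicValRat p a = 0) (hns : ¬ IsSquare (res p a))
    {z : QuadraticAlgebra ℚ a 0} (hz : z ≠ 0) : padicValRat p z.norm = 2 * cval p z := by
  have hp0 : (p : ℚ) ≠ 0 := Nat.cast_ne_zero.mpr hp.out.ne_zero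
  set m := cval p z with hm
  -- rescale to valuation `0`
  set z' : QuadraticAlgebra ℚ a 0 := ((p : ℚ) ^ (-m)) • z with hz'
  have hpm : (p : ℚ) ^ (-m) ≠ 0 := zpow_ne_zero _ hp0
  have hz'0 : z' ≠ 0 := by
    rw [hz']; exact smul_ne_zero hpm hz
  have hc' : cval p z' = 0 := by rw [hz', cval_smul_zpow p (-m) hz]; omega
  have hdom : Dom p 0 z' := hc' ▸ dom_cval p z'
  have hunit := exists_coord_eq_cval p hz'0
  rw [hc'] at hunit
  have hN' : z'.norm ≠ 0 := fun h0 => hz'0 (norm_eq_zero_iff_eq_zero.mp h0)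
  have hv' : padicValRat p z'.norm = 0 := by
    rw [norm_eq] at hN' ⊢
    exact padicValRat_norm_form_eq_zero ha hns hdom.1 hdom.2 hunit hN'
  -- undo the scaling
  have hzz : z = ((p : ℚ) ^ m) • z' := by
    rw [hz', smul_smul, ← zpow_add₀ hp0, add_neg_cancel, zpow_zero, one_smul]
  have hN0 : z'.norm ≠ 0 := hN'
  rw [hzz, norm_smul, padicValRat.mul (pow_ne_zero 2 (zpow_ne_zero _ hp0)) hN0, hv',
    ← zpow_natCast, ← zpow_mul, padicValRat.zpow, padicValRat.self hp.out.one_lt]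
  push_cast
  ring

/-- In particular `v_p(N z)` is even. [folklore] -/
theorem even_padicValRat_norm [Fact (∀ r : ℚ, r ^ 2 ≠ a + 0 * r)]
    (ha : padicValRat p a = 0) (hns : ¬ IsSquare (res p a))
    {z : QuadraticAlgebra ℚ a 0} (hz : z ≠ 0) : Even (padicValRat p z.norm) :=
  ⟨cval p z, by rw [padicValRat_norm_eq_two_mul p ha hns hz, two_mul]⟩

/-! ### The inert place -/

/-- Domination for a product of dominated coordinates: if `s`, `t` are `0` or have valuations
`≥ m`, `≥ n`, then `s t` is `0` or has valuation `≥ m + n`. [folklore] -/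
theorem dom_mul_aux {s t : ℚ} {m n : ℤ} (hs : s = 0 ∨ m ≤ padicValRat p s)
    (ht : t = 0 ∨ n ≤ padicValRat p t) : s * t = 0 ∨ m + n ≤ padicValRat p (s * t) := by
  rcases hs with rfl | hs
  · exact Or.inl (zero_mul _)
  rcases ht with rfl | ht
  · exact Or.inl (mul_zero _)
  by_cases hs0 : s = 0
  · exact Or.inl (by rw [hs0, zero_mul])
  by_cases ht0 : t = 0
  · exact Or.inl (by rw [ht0, mul_zero])
  exact Or.inr (by rw [padicValRat.mul hs0 ht0]; omega)

/-- Scaling a dominated rational by a constant. [folklore] -/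
theorem dom_const_mul_aux {t : ℚ} {n : ℤ} (c : ℚ) (hc : c = 0 ∨ 0 ≤ padicValRat p c)
    (ht : t = 0 ∨ n ≤ padicValRat p t) : c * t = 0 ∨ n ≤ padicValRat p (c * t) := by
  have := dom_mul_aux p hc ht
  rwa [zero_add] at this

end QuadInert

open QuadInert

variable (p : ℕ) [hp : Fact p.Prime] (a : ℚ) [Fact (∀ r : ℚ, r ^ 2 ≠ a + 0 * r)]

/-- **The place of `K = ℚ(√a)` at an inert odd prime `p`, as an abstract odd place**, under the
hypotheses `v_p(a) = 0`, `a` a non-square mod `p`: valuation `v z = v_p(N z) / 2` and residue bit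
`χ z = qrBit p (N z)` (the quadratic-residue bit of the `p`-unit part of the norm).
[folklore] -/
def inertPlace (ha : padicValRat p a = 0) (hns : ¬ IsSquare (res p a)) :
    OddPlace (QuadraticAlgebra ℚ a 0) where
  v z := padicValRat p z.norm / 2
  χ z := qrBit p z.norm
  v_mul' := by
    intro z w hz hw
    have hNz : z.norm ≠ 0 := fun h0 => hz (norm_eq_zero_iff_eq_zero.mp h0)
    have hNw : w.norm ≠ 0 := fun h0 => hw (norm_eq_zero_iff_eq_zero.mp h0)
    rw [map_mul, padicValRat.mul hNz hNw, padicValRat_norm_eq_two_mul p ha hns hz,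
      padicValRat_norm_eq_two_mul p ha hns hw]
    omega
  min_le_v_add' := by
    intro z w hz hw hzw
    rw [padicValRat_norm_eq_two_mul p ha hns hz, padicValRat_norm_eq_two_mul p ha hns hw,
      padicValRat_norm_eq_two_mul p ha hns hzw]
    have h1 : Dom p (min (cval p z) (cval p w)) z := (dom_cval p z).mono p (min_le_left _ _)
    have h2 : Dom p (min (cval p z) (cval p w)) w := (dom_cval p w).mono p (min_le_right _ _)
    have h3 := le_cval_of_dom p hzw (h1.add p h2)
    omega
  χ_mul' := by
    intro z w hz hw
    have hNz : z.norm ≠ 0 := fun h0 => hz (norm_eq_zero_iff_eq_zero.mp h0)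
    have hNw : w.norm ≠ 0 := fun h0 => hw (norm_eq_zero_iff_eq_zero.mp h0)
    rw [map_mul, qrBit_mul p hNz hNw]
  χ_add_of_lt' := by
    intro z w hz hw hlt
    have hNz : z.norm ≠ 0 := fun h0 => hz (norm_eq_zero_iff_eq_zero.mp h0)
    rw [padicValRat_norm_eq_two_mul p ha hns hz, padicValRat_norm_eq_two_mul p ha hns hw] at hlt
    have hlt' : cval p z < cval p w := by omega
    -- `N(z + w) = N z + E` with `v(E) > v(N z)`
    have ha' : a = 0 ∨ 0 ≤ padicValRat p a := Or.inr ha.ge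
    set E : ℚ := 2 * (z.re * w.re) + w.re * w.re - a * (2 * (z.im * w.im) + w.im * w.im) with hE
    have hsum : (z + w).norm = z.norm + E := by
      rw [norm_eq, norm_eq, re_add, im_add, hE]; ring
    obtain ⟨hzr, hzi⟩ := dom_cval p z
    obtain ⟨hwr, hwi⟩ := dom_cval p w
    have two' : (2 : ℚ) = 0 ∨ 0 ≤ padicValRat p (2 : ℚ) :=
      Or.inr (by rw [show (2 : ℚ) = ((2 : ℤ) : ℚ) by norm_num]; exact padicValRat_intCast_nonneg _)
    have t1 := dom_const_mul_aux p 2 two' (dom_mul_aux p hzr hwr)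
    have t2 := dom_mul_aux p hwr hwr
    have t3 := dom_const_mul_aux p 2 two' (dom_mul_aux p hzi hwi)
    have t4 := dom_mul_aux p hwi hwi
    have t34 := le_padicValRat_add_or (p := p) (c := cval p z + cval p w) t3
      (t4.imp_right fun h => by omega)
    have t34' := dom_const_mul_aux p a ha' t34
    have t12 := le_padicValRat_add_or (p := p) (c := cval p z + cval p w) t1
      (t2.imp_right fun h => by omega)
    have t34n : -(a * (2 * (z.im * w.im) + w.im * w.im)) = 0 ∨
        cval p z + cval p w ≤ padicValRat p (-(a * (2 * (z.im * w.im) + w.im * w.im))) :=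
      t34'.imp (fun h => by rw [h, neg_zero]) (fun h => by rwa [padicValRat.neg])
    have hEdom : E = 0 ∨ cval p z + cval p w ≤ padicValRat p E := by
      have := le_padicValRat_add_or (p := p) (c := cval p z + cval p w) t12 t34n
      rwa [hE, sub_eq_add_neg]
    apply qrBit_congr p
    rw [hsum]
    refine res_add_of_lt p hNz (hEdom.imp_right fun h => ?_)
    rw [padicValRat_norm_eq_two_mul p ha hns hz]
    omega

/-- The valuation of the inert place. [folklore] -/
@[simp] theorem inertPlace_v (ha : padicValRat p a = 0) (hns : ¬ IsSquare (res p a))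
    (z : QuadraticAlgebra ℚ a 0) : (inertPlace p a ha hns).v z = padicValRat p z.norm / 2 := rfl

/-- The residue bit of the inert place. [folklore] -/
@[simp] theorem inertPlace_χ (ha : padicValRat p a = 0) (hns : ¬ IsSquare (res p a))
    (z : QuadraticAlgebra ℚ a 0) : (inertPlace p a ha hns).χ z = qrBit p z.norm := rfl

/-- The valuation of the inert place is the coordinate valuation. [folklore] -/
theorem inertPlace_v_eq_cval (ha : padicValRat p a = 0) (hns : ¬ IsSquare (res p a))
    {z : QuadraticAlgebra ℚ a 0} (hz : z ≠ 0) : (inertPlace p a ha hns).v z = cval p z := by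
  rw [inertPlace_v, padicValRat_norm_eq_two_mul p ha hns hz]
  omega

/-- Twice the valuation of the inert place is `v_p` of the norm. [folklore] -/
theorem two_mul_inertPlace_v (ha : padicValRat p a = 0) (hns : ¬ IsSquare (res p a))
    {z : QuadraticAlgebra ℚ a 0} (hz : z ≠ 0) :
    2 * (inertPlace p a ha hns).v z = padicValRat p z.norm := by
  rw [inertPlace_v_eq_cval p a ha hns hz, padicValRat_norm_eq_two_mul p ha hns hz]

/-- The parity bit of the inert place vanishes iff `4 ∣ v_p(N z)`. [folklore] -/
theorem inertPlace_parity_eq_zero_iff (ha : padicValRat p a = 0) (hns : ¬ IsSquare (res p a))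
    {z : QuadraticAlgebra ℚ a 0} (hz : z ≠ 0) :
    (inertPlace p a ha hns).parity z = 0 ↔ (4 : ℤ) ∣ padicValRat p z.norm := by
  rw [OddPlace.parity_eq_zero_iff, ← two_mul_inertPlace_v p a ha hns hz, even_iff_two_dvd]
  constructor
  · rintro ⟨k, hk⟩; exact ⟨k, by rw [hk]; ring⟩
  · rintro ⟨k, hk⟩; exact ⟨k, by omega⟩

end Literature.NumberTheory.EllipticCurves.TwoDescentLocal

end
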